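import Mathlib
import Summits.Ventures.PercRepro2.Defs
import Summits.Ventures.PercRepro2.Graph
import Summits.Ventures.PercRepro2.Harris
import Summits.Ventures.PercRepro2.Events
import Summits.Ventures.PercRepro2.Induced
import Summits.Ventures.PercRepro2.BHKAvoid
import Summits.Ventures.PercRepro2.RowC1PendZCells

/-!
# Instance (I18) of the certificate of `zpp ≥ 0`: cross-cluster BHK under avoidance (blind cell PercRepro2, p2 g36)

`bhk_cross_cluster_avoid` with `s = v`, `t = a₂`, `X = {a₂, b}`, `𝓤 = {W | o ∈ W}` (at `s`), `𝓥 = {W | b ∈ W}`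
(at `t`), written on the fifteen pattern cells exactly as `zpp_cert_alg` / `zpp_nonneg_of_bhk` want it
(`inst18_cells`; proofs/P2-G36-CERT-ZPP.md, P2-G36-SYM.md §7).  Std axioms.
-/

namespace Summit.Ventures.PercRepro2

namespace RowC1

section Inst18

variable {V : Type*} {E : Type*} [Fintype E] [DecidableEq E] [Fintype V] [DecidableEq V]
  {R : Type*} [Field R] [LinearOrder R] [IsStrictOrderedRing R]

omit [Fintype E] [DecidableEq E] [Fintype V] [DecidableEq V] [LinearOrder R] [IsStrictOrderedRing R] in
/-- orientation of a connection. -/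
lemma conn_swap_18 (ends : E → Sym2 V) (ω : Config E) (x y : V) :
    Conn ends ω x y ↔ Conn ends ω y x := ⟨conn_symm, conn_symm⟩

omit [Fintype V] [LinearOrder R] [IsStrictOrderedRing R] in
/-- cell expansion of the event `UWR` (instance I18). -/
theorem cs18_UWR (p : E → R) (ends : E → Sym2 V) (v a₂ o b : V) :
    prob p (clusterInEvent ends v {W : Set V | o ∈ W} ∩ clusterInEvent ends a₂ {W : Set V | b ∈ W} ∩ avoidAll ends v {a₂, b}) = (prob p (cell ends v a₂ o b 12)) := by
  have e : (clusterInEvent ends v {W : Set V | o ∈ W} ∩ clusterInEvent ends a₂ {W : Set V | b ∈ W} ∩ avoidAll ends v {a₂, b}) = {ω | ((Nat.testBit (pattern ends v a₂ o b ω).val 3 = true ∧ Nat.testBit (pattern ends v a₂ o b ω).val 2 = true) ∧ ((¬ Nat.testBit (pattern ends v a₂ o b ω).val 0 = true) ∧ (¬ Nat.testBit (pattern ends v a₂ o b ω).val 4 = true)))} := by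
    ext ω
    simp only [Set.mem_inter_iff, mem_clusterInEvent, Set.mem_setOf_eq, mem_cluster, mem_avoidAll, Finset.mem_insert, Finset.mem_singleton, forall_eq_or_imp, forall_eq, conn_swap_18 ends ω v a₂, testBit_pattern_zero, testBit_pattern_two, testBit_pattern_three, testBit_pattern_four]
  rw [e, prob_pattern_eq_sum_trans p ends v a₂ o b (fun n => ((Nat.testBit n.val 3 = true ∧ Nat.testBit n.val 2 = true) ∧ ((¬ Nat.testBit n.val 0 = true) ∧ (¬ Nat.testBit n.val 4 = true))))]
  rw [show (Finset.univ.filter (fun n : Fin 64 => IsTrans6 n ∧ ((Nat.testBit n.val 3 = true ∧ Nat.testBit n.val 2 = true) ∧ ((¬ Nat.testBit n.val 0 = true) ∧ (¬ Nat.testBit n.val 4 = true))))) = ({12} : Finset (Fin 64)) by decide]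
  simp only [Finset.sum_singleton]
omit [Fintype V] [LinearOrder R] [IsStrictOrderedRing R] in
/-- cell expansion of the event `R` (instance I18). -/
theorem cs18_R (p : E → R) (ends : E → Sym2 V) (v a₂ o b : V) :
    prob p (avoidAll ends v {a₂, b}) = (prob p (cell ends v a₂ o b 38) + prob p (cell ends v a₂ o b 2) + prob p (cell ends v a₂ o b 12) + prob p (cell ends v a₂ o b 8) + prob p (cell ends v a₂ o b 4) + prob p (cell ends v a₂ o b 32) + prob p (cell ends v a₂ o b 0)) := by
  have e : (avoidAll ends v {a₂, b}) = {ω | ((¬ Nat.testBit (pattern ends v a₂ o b ω).val 0 = true) ∧ (¬ Nat.testBit (pattern ends v a₂ o b ω).val 4 = true))} := by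
    ext ω
    simp only [Set.mem_setOf_eq, mem_avoidAll, Finset.mem_insert, Finset.mem_singleton, forall_eq_or_imp, forall_eq, conn_swap_18 ends ω v a₂, testBit_pattern_zero, testBit_pattern_four]
  rw [e, prob_pattern_eq_sum_trans p ends v a₂ o b (fun n => ((¬ Nat.testBit n.val 0 = true) ∧ (¬ Nat.testBit n.val 4 = true)))]
  rw [show (Finset.univ.filter (fun n : Fin 64 => IsTrans6 n ∧ ((¬ Nat.testBit n.val 0 = true) ∧ (¬ Nat.testBit n.val 4 = true)))) = ({38, 2, 12, 8, 4, 32, 0} : Finset (Fin 64)) by decide]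
  simp +decide only [Finset.sum_insert, Finset.mem_insert, Finset.mem_singleton, Finset.sum_singleton]
  ring
omit [Fintype V] [LinearOrder R] [IsStrictOrderedRing R] in
/-- cell expansion of the event `UR` (instance I18). -/
theorem cs18_UR (p : E → R) (ends : E → Sym2 V) (v a₂ o b : V) :
    prob p (clusterInEvent ends v {W : Set V | o ∈ W} ∩ avoidAll ends v {a₂, b}) = (prob p (cell ends v a₂ o b 12) + prob p (cell ends v a₂ o b 8)) := by
  have e : (clusterInEvent ends v {W : Set V | o ∈ W} ∩ avoidAll ends v {a₂, b}) = {ω | (Nat.testBit (pattern ends v a₂ o b ω).val 3 = true ∧ ((¬ Nat.testBit (pattern ends v a₂ o b ω).val 0 = true) ∧ (¬ Nat.testBit (pattern ends v a₂ o b ω).val 4 = true)))} := by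
    ext ω
    simp only [Set.mem_inter_iff, mem_clusterInEvent, Set.mem_setOf_eq, mem_cluster, mem_avoidAll, Finset.mem_insert, Finset.mem_singleton, forall_eq_or_imp, forall_eq, conn_swap_18 ends ω v a₂, testBit_pattern_zero, testBit_pattern_three, testBit_pattern_four]
  rw [e, prob_pattern_eq_sum_trans p ends v a₂ o b (fun n => (Nat.testBit n.val 3 = true ∧ ((¬ Nat.testBit n.val 0 = true) ∧ (¬ Nat.testBit n.val 4 = true))))]
  rw [show (Finset.univ.filter (fun n : Fin 64 => IsTrans6 n ∧ (Nat.testBit n.val 3 = true ∧ ((¬ Nat.testBit n.val 0 = true) ∧ (¬ Nat.testBit n.val 4 = true))))) = ({12, 8} : Finset (Fin 64)) by decide]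
  simp +decide only [Finset.sum_insert, Finset.mem_singleton, Finset.sum_singleton]
omit [Fintype V] [LinearOrder R] [IsStrictOrderedRing R] in
/-- cell expansion of the event `WR` (instance I18). -/
theorem cs18_WR (p : E → R) (ends : E → Sym2 V) (v a₂ o b : V) :
    prob p (clusterInEvent ends a₂ {W : Set V | b ∈ W} ∩ avoidAll ends v {a₂, b}) = (prob p (cell ends v a₂ o b 38) + prob p (cell ends v a₂ o b 12) + prob p (cell ends v a₂ o b 4)) := by
  have e : (clusterInEvent ends a₂ {W : Set V | b ∈ W} ∩ avoidAll ends v {a₂, b}) = {ω | (Nat.testBit (pattern ends v a₂ o b ω).val 2 = true ∧ ((¬ Nat.testBit (pattern ends v a₂ o b ω).val 0 = true) ∧ (¬ Nat.testBit (pattern ends v a₂ o b ω).val 4 = true)))} := by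
    ext ω
    simp only [Set.mem_inter_iff, mem_clusterInEvent, Set.mem_setOf_eq, mem_cluster, mem_avoidAll, Finset.mem_insert, Finset.mem_singleton, forall_eq_or_imp, forall_eq, conn_swap_18 ends ω v a₂, testBit_pattern_zero, testBit_pattern_two, testBit_pattern_four]
  rw [e, prob_pattern_eq_sum_trans p ends v a₂ o b (fun n => (Nat.testBit n.val 2 = true ∧ ((¬ Nat.testBit n.val 0 = true) ∧ (¬ Nat.testBit n.val 4 = true))))]
  rw [show (Finset.univ.filter (fun n : Fin 64 => IsTrans6 n ∧ (Nat.testBit n.val 2 = true ∧ ((¬ Nat.testBit n.val 0 = true) ∧ (¬ Nat.testBit n.val 4 = true))))) = ({38, 12, 4} : Finset (Fin 64)) by decide]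
  simp +decide only [Finset.sum_insert, Finset.mem_insert, Finset.mem_singleton, Finset.sum_singleton]
  ring

/-- **instance (I18)** on the cells (`bhk_cross_cluster_avoid`, `s = v`, `t = a₂`, `X = {a₂, b}`). -/
theorem inst18_cells (p : E → R) (hp : IsProbVec p) (ends : E → Sym2 V) (v a₂ o b : V) :
    (prob p (cell ends v a₂ o b 12)) * (prob p (cell ends v a₂ o b 38) + prob p (cell ends v a₂ o b 2) + prob p (cell ends v a₂ o b 12) + prob p (cell ends v a₂ o b 8) + prob p (cell ends v a₂ o b 4) + prob p (cell ends v a₂ o b 32) + prob p (cell ends v a₂ o b 0)) ≤ (prob p (cell ends v a₂ o b 12) + prob p (cell ends v a₂ o b 8)) * (prob p (cell ends v a₂ o b 38) + prob p (cell ends v a₂ o b 12) + prob p (cell ends v a₂ o b 4)) := by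
  classical
  have H := bhk_cross_cluster_avoid p hp ends v a₂ (X := {a₂, b}) (Finset.mem_insert_self a₂ {b})
    (𝓤 := {W : Set V | o ∈ W}) (𝓥 := {W : Set V | b ∈ W})
    (fun _ _ h hu => h hu) (fun _ _ h hw => h hw)
  rw [cs18_UWR p ends v a₂ o b, cs18_R p ends v a₂ o b, cs18_UR p ends v a₂ o b,
    cs18_WR p ends v a₂ o b] at H
  linarith [H]

end Inst18

end RowC1

end Summit.Ventures.PercRepro2
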